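import Summits.Parity.GeneralizedHardyLittlewood.Theses.TwinMinorArcs

/-!
# Birth skeleton (BC3) for crux `TupleMinorArcUniformity` — route TwinMinorArcs, item stmt-Parity-13150

Line `birth` = the crux ("Vinogradov for prime tuples": for every fixed non-degenerate
one-dimensional system `Φ`, `sup` over the minor arcs of `|∑_{n ≤ N} ∏ᵢ Λ(φᵢ(n)) e(nα)| = o(N)`)
cut at the ONE classical joint of every minor-arc theorem for primes — the height of the
Dirichlet approximation — into its two ranges, each a different mechanism, glued by a
kernel-checked Dirichlet argument (`TupleMinorArcUniformity_of_ranges`, no `sorry`; fed with the two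
stubs it is `TupleMinorArcUniformity_of : TwinMinorArcs.TupleMinorArcUniformity`, by name).

**Idea.** Write `S_Φ(N, α) = ∑_{n ≤ N} ∏ᵢ Λ(φᵢ(n)) e(nα)` and `L = (log N)^K`. By Dirichlet's
theorem at height `T = max 1 ⌊N/L⌋` (Mathlib `Real.exists_rat_abs_sub_le_and_den_le`) every `α`
has a reduced `a/q` with `q ≤ T` and `|α − a/q| ≤ 1/((T+1)q) < L/(qN)` (and `≤ 1/q²`). Either
`q < L`: then `α` lies in the level-`L` major arcs `𝔐(L)` but — by the crux's hypothesis — off the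
level-`Q` major arcs `𝔐(Q)`, and `stub_polylogConductors` (stated for EVERY `K`) bounds `S_Φ`;
or `L ≤ q ≤ N/L`: the Vinogradov range, and `stub_deepMinorArcs` (stated for SOME `K`) bounds
`S_Φ`. (Small `N` with `N < L`: `q = 1`, `a = round α` is already shallow.) The `K` of the deep
stub is fed to the shallow stub; the crux's `Q` is the shallow stub's `Q`; `N₀ = max`.
This is the tuple version of the route's foreseen two-layer plan for the twin instance
(`TwinVinogradovInequality → PolylogConductorUniformity → TwinMinorArcUniformity`), with one
CORRECTION recorded here: the plan's Dirichlet height `τ = N/Q` does not glue (it leaves the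
denominators `q ∈ (N/(log N)^A, N/Q]`, where a log-lossy engine bound `C N (log N)^B (q/N)^c` is
useless, and — at height `N/(log N)^A` instead — the region `q ≤ Q`, `Q/N < |β| ≤ (log N)^A/(qN)`);
the height must be `N/(log N)^K` and the shallow statement must cover `𝔐((log N)^K) ∖ 𝔐(Q)`
including `q ≤ Q` with intermediate `β`. Both corrections are built into the two signatures below.

**Stubs.**
* `stub_deepMinorArcs` (the VINOGRADOV RANGE, rate-free; L–XL, open for `t ≥ 2`): for fixed
  non-degenerate `Φ` and `ε > 0` there are `K, N₀` with `|S_Φ(N, α)| ≤ εN` whenever `N ≥ N₀`,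
  `(a, q) = 1`, `(log N)^K ≤ q ≤ N/(log N)^K`, `|α − a/q| ≤ 1/q²`. Why plausibly true: it is what any
  Vinogradov-type inequality `|S_Φ| ≤ C N (log N)^B (q^{−c} + (q/N)^c)` delivers with
  `K = ⌈(B+1)/c⌉` (the route's rank-3 engine statement `TwinVinogradovInequality` is the twin case;
  its proposed proof is the double Heath-Brown opening with the twisted determinant core); at
  `t = 1` it is a THEOREM — tree `Literature.NumberTheory.Sieve.vinogradov_primeExpSumLog_bound`
  (Vaughan: `C (N q^{−1/2} + N^{4/5} + N^{1/2} q^{1/2}) (log N)⁴`, so `K = 10` works for `Φ = (n)`;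
  `Φ = (an + b)` is Balog–Perelli 1985). It is also a consequence of the crux for large `N` (a
  reduced `a/q` with `q ≥ (log N)^K > Q²` and `|β| ≤ 1/q²`, `q ≤ N/(log N)^K`, is at distance
  `> Q/N` from every `a'/q'`, `q' ≤ Q`). Why it might fail: for `t ≥ 2` it needs cancellation in a
  2-point (for `t ≥ 3`, `t`-point) Möbius sum along lines with a linear twist — no engine exists
  (MRT Fourier uniformity is 1-point and interval-averaged; Matomäki–Shao reach only sieve-weighted
  almost-twins). Leans on: nothing beyond the definitions; the t = 1 anchor above.
  [cite: VaughanHL1997, Thm 3.1] [cite: Nathanson1996, Thm 8.5] [cite: MatomakiShao2017, Thm 1.1]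
* `stub_polylogConductors` (the SIEGEL–WALFISZ RANGE, `𝔐((log N)^K) ∖ 𝔐(Q)`, for EVERY `K`;
  L–XL, open for `t ≥ 2`): for fixed non-degenerate `Φ`, every `K` and `ε > 0` there are `Q > 0`,
  `N₀` such that for `N ≥ N₀`, every `α` off the level-`Q` major arcs (the crux's hypothesis,
  verbatim) and every reduced `a/q` with `q < (log N)^K`, `|α − a/q| ≤ (log N)^K/(qN)`:
  `|S_Φ(N, α)| ≤ εN`. Two sub-regions: `Q < q < (log N)^K` ("tuples carry no slowly-modulated bias
  to polylog conductors": expected size `|c_Φ(a,q)|·N/… → 0` as `q → ∞` along the singular-series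
  coefficients, plus `o(N)`), and `q ≤ Q`, `Q/N < |β| ≤ (log N)^K/(qN)` (expected
  `|c_Φ(a,q)|/(2|β|) + o(N) ≤ C_Φ N/(2Q) + o(N)`, so `Q ≥ C_Φ/ε` — the `∃ Q` is essential: with the
  major arcs not excised the statement is false at `α = a/q`). Why plausibly true: it is implied by
  the crux (drop the `a, q` data), hence by GHL via the route's support `GHLForcesTwinUniformity`
  argument (fourth moment); at `t = 1` it is a THEOREM — Siegel–Walfisz (tree, PROVED:
  `Literature.NumberTheory.LFunctions.siegel_walfisz_holds`) + partial summation over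
  `|β| ≤ (log N)^K/(qN)` (Vaughan Lemma 3.1 / Nathanson Thm 8.2–8.3, error `N (1 + |β|N)(log N)^{−2K−1}`).
  Siegel-insensitive in the crux's sense: an exceptional character mod `q₁` biases `Ŝ_Φ(a/q₁)` by
  `≪ N q₁^{−1/2+o(1)}` (Weil), harmless once `q₁ > Q ≥ ε^{−2−o(1)}`, and for `q₁ ≤ Q` the bias, like the
  main term, is damped by the oscillation `|β| > Q/N`. Why it might fail: for `t ≥ 2` the analogue
  of the zero-free region / Siegel–Walfisz input does not exist (tuple measures have no
  `L`-function); the statement asserts regularity of the tuple measure in progressions of polylog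
  modulus at every scale `N/(log N)^K` — beyond sieve axioms plus positivity, beyond lossy
  bilinear bounds. Leans on: nothing beyond the definitions; the t = 1 anchor above.
  [cite: VaughanHL1997, Lemma 3.1 and §3.4] [cite: Nathanson1996, Thms 8.2–8.3]
  [cite: MatomakiRadziwillTao2020Fourier] [cite: BienvenuShaoTeravainen2023, Thm 1.1]

**Hardest stub:** `stub_polylogConductors` — no mechanism is even proposed for it (for primes the
range is paid by `L(s, χ)`; the route's bilinear engine addresses only the deep range), and it
carries the intermediate-`β` region that the route's two-layer plan overlooked. `stub_deepMinorArcs`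
is where the route's engine (rank 3, twisted determinant core) acts; it is the natural first target.

**Barriers** (catalogue `Literature/Barriers/Parity/`). `CircleMethodBinaryBarrier` /
`RedactedPrimes`: not engaged — both stubs and the glue are SIZE bounds on a tuple-weighted
exponential sum and decide no binary count; the route consumes them only for cluster
configurations of complexity `≤ 1` in `≥ 2` cluster variables, with every binary count
(`BoundedDickson`) a separate hypothesis. `TrueComplexityBinary`: not engaged — no Gowers/Fourier
norm is applied across a parallel pair `(n, n+2)`; uniformity is in the free variable `n` against
`e(nα)` only. `SelbergParityBarrier` / `PrimePairParity`: not formally engaged (no sieve lower bound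
is derived; both stubs are main-term-free oscillation bounds, invariant under the Bombieri ghost
reweighting `1 ± λ(n)λ(n+2)`); honest caveat — the bet of the whole route is that minor-arc
cancellation for a 2-point prime correlation is accessible although its asymptotic is not.
`SiegelZeroPrimePairBarrier` / `BrunTitchmarshSiegelZero`: evaded as explained under Stub 2 (Weil
damping `q^{−1/2}` beyond `Q`, `|β|`-damping below `Q`); no shift-uniformity is claimed (`Φ` is fixed
before `ε, K, Q, N₀` — contrast the refuted `InverseSieveTuples.TupleElliott`, killed by shifts of
size `≍ N`). `MaierMatrix` / `FriedlanderGranvilleUniformity`: not engaged (scales `N/(log N)^K`,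
moduli `≤ (log N)^K`, never `(log N)^λ`-short intervals or moduli near `N`).

**Disproof used:** none exists for this crux (`ledger crux ls stmt-Parity-13150`: no workfiles, no
`Disproof.lean`, 2026-08-17). Negatives index (`ledger negatives --problem Parity`, 3 entries:
convolution-moment level-one sieve axiom 9541, `TupleElliott` 14832, `RectangleChowla` 4218): none
concerns additive twists; neither stub is an instance or a rewording of any of them (both fix `Φ`
first; no level of distribution, no multiplicative twist, no pretentious hypothesis).
**Dead lines:** none recorded for this crux.

**Cheapest falsifier.** Stub 2: `max_a |∑_{n ≤ N} Λ(n)Λ(n+2) e(an/q)|/N` at prime conductors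
`q ∈ [50, 5000]`, `N = 10⁷…10⁸` (the route's kit item (2); the refuter's FFT job j003903 on six
systems auto-attaches to the item): a plateau `≍ N` not decaying in `q` kills Stub 2 and the crux.
Stub 1: the same sup over `10⁴` deep minor-arc `α` — square-root size expected. In Lean, cheapest:
the `t = 1` instances of both stubs from the two tree theorems named above (M-size jobs, good
`--supports` lemmas).

**BC3 audit (this seat, 2026-08-17).** `lean check --json` on this file: rc 0, `sorries = 2` =
the two `stub_*` (warnings at their two declaration lines only, zero elsewhere);
`TupleMinorArcUniformity_of_ranges : deep → shallow → (crux formula)` has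
`#print axioms` = `[propext, Classical.choice, Quot.sound]`; `TupleMinorArcUniformity_of` concludes the
route decl `Summit.Parity.GeneralizedHardyLittlewood.Theses.TwinMinorArcs.TupleMinorArcUniformity` BY NAME
with no hypotheses (its axioms add only the stubs' `sorryAx`); `ledger skeleton check` verdict recorded in
the seat's NOTES.md. Probes (seat folder `bc/probe_*.lean`,
importing only the route module, the stub signature restated as `def StubSig`, no sibling stub and no
`_of` in scope; one `example` per tactic of `exact? | simpa | simpa [defs] | (unfold defs; simpa) |
aesop`, `maxHeartbeats 400000`): all 20 FAIL — `stub → TupleMinorArcUniformity`: `exact?`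
deterministic timeout at the budget (and at 10× the budget; with the crux unfolded too: "`exact?`
could not close the goal"), `simpa`×3 "assumption failed", `aesop` "failed to prove the goal after
exhaustive search"; `stub → GeneralizedHardyLittlewood`: "`exact?` could not close the goal",
`simpa`×3 "assumption failed", `aesop` exhaustive search failed — for both stubs. No stub is cheaply
the crux or the summit; the split is by mechanism (Vinogradov range / Siegel–Walfisz range), not a
slicing of one difficulty.
-/

namespace Summit.Parity.GeneralizedHardyLittlewood.Cruxes.TupleMinorArcUniformity.Birth

open scoped BigOperators Topology Manifold Classical MeasureTheory ProbabilityTheory Matrix InnerProductSpace ComplexConjugate ContinuousMap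
open Filter Set Function TopologicalSpace MeasureTheory

/-! ### The stubs -/

/-- **Stub 1 — deep minor arcs (the Vinogradov range), rate-free; open for `t ≥ 2`, a theorem at
`t = 1`.** For every fixed non-degenerate one-dimensional system `Φ` and `ε > 0` there are `K, N₀`
such that `|∑_{n ≤ N} ∏ᵢ Λ(φᵢ(n)) e(nα)| ≤ εN` whenever `N ≥ N₀` and `α` is within `1/q²` of a
reduced fraction `a/q` with `(log N)^K ≤ q ≤ N/(log N)^K` (written `q · (log N)^K ≤ N`). What a
Vinogradov-type inequality `C N (log N)^B (q^{−c} + (q/N)^c)` for the tuple measure gives with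
`K = ⌈(B+1)/c⌉`; `t = 1`: tree `vinogradov_primeExpSumLog_bound` (`K = 10`).
[cite: VaughanHL1997, Thm 3.1] [cite: Nathanson1996, Thm 8.5] [cite: MatomakiShao2017, Thm 1.1] -/
theorem stub_deepMinorArcs :
    ∀ (t : ℕ) (Φ : Fin t → Literature.NumberTheory.Sieve.AffLinForm 1), 1 ≤ t →
      Literature.NumberTheory.Sieve.IsNondegenerateSystem Φ → ∀ ε : ℝ, 0 < ε →
        ∃ K N₀ : ℕ, ∀ N : ℕ, N₀ ≤ N → ∀ (α : ℝ) (a : ℤ) (q : ℕ), 1 ≤ q → Int.gcd a q = 1 →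
          Real.log N ^ K ≤ q → (q : ℝ) * Real.log N ^ K ≤ N → |α - a / q| ≤ 1 / (q : ℝ) ^ 2 →
            ‖∑ n ∈ Finset.Icc 1 N, ((∏ i, Literature.NumberTheory.Sieve.intVonMangoldt ((Φ i).eval ![(n : ℤ)]) : ℝ) : ℂ) * Complex.exp (2 * Real.pi * Complex.I * (α * n))‖ ≤ ε * N := by
  sorry

/-- **Stub 2 — the Siegel–Walfisz range `𝔐((log N)^K) ∖ 𝔐(Q)`, for every `K`; open for `t ≥ 2`,
a theorem at `t = 1`.** For every fixed non-degenerate one-dimensional system `Φ`, every `K` and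
`ε > 0` there are `Q > 0` and `N₀` such that for `N ≥ N₀`, every `α` OFF the level-`Q` major arcs
(the crux's hypothesis verbatim: `Q/N < |α − a'/q'|` for all `q' ≤ Q`) and every reduced `a/q` with
`q < (log N)^K` and `|α − a/q| ≤ (log N)^K/(qN)`: `|∑_{n ≤ N} ∏ᵢ Λ(φᵢ(n)) e(nα)| ≤ εN` ("tuple
measures carry no slowly-modulated bias to polylog conductors"; includes `q ≤ Q` with
`Q/N < |β| ≤ (log N)^K/(qN)`, where the expected size is `|c_Φ(a,q)|/(2|β|) + o(N) ≤ C_Φ N/(2Q) + o(N)`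
— hence `∃ Q`). `t = 1`: tree `siegel_walfisz_holds` + partial summation.
[cite: VaughanHL1997, Lemma 3.1] [cite: Nathanson1996, Thms 8.2–8.3] [cite: MatomakiRadziwillTao2020Fourier] -/
theorem stub_polylogConductors :
    ∀ (t : ℕ) (Φ : Fin t → Literature.NumberTheory.Sieve.AffLinForm 1), 1 ≤ t →
      Literature.NumberTheory.Sieve.IsNondegenerateSystem Φ → ∀ (K : ℕ) (ε : ℝ), 0 < ε →
        ∃ Q : ℝ, 0 < Q ∧ ∃ N₀ : ℕ, ∀ N : ℕ, N₀ ≤ N → ∀ α : ℝ,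
          (∀ q : ℕ, 1 ≤ q → (q : ℝ) ≤ Q → ∀ a : ℤ, Q / N < |α - a / q|) →
            ∀ (a : ℤ) (q : ℕ), 1 ≤ q → Int.gcd a q = 1 → (q : ℝ) < Real.log N ^ K →
              |α - a / q| ≤ Real.log N ^ K / (q * N) →
                ‖∑ n ∈ Finset.Icc 1 N, ((∏ i, Literature.NumberTheory.Sieve.intVonMangoldt ((Φ i).eval ![(n : ℤ)]) : ℝ) : ℂ) * Complex.exp (2 * Real.pi * Complex.I * (α * n))‖ ≤ ε * N := by
  sorry

/-! ### The assembly (real proof): Dirichlet's approximation theorem at height `N / (log N)^K`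

Two theorems: `TupleMinorArcUniformity_of_ranges` is the composition with the two stub STATEMENTS as
hypotheses (fully proved, axioms `[propext, Classical.choice, Quot.sound]`); its conclusion is the crux's
definiens verbatim, so that `TupleMinorArcUniformity_of` — which feeds it the two stubs and concludes the
route decl BY NAME with no `Prop` hypotheses (the A12 skeleton-audit shape, `ledger skeleton check`) — is
the unique theorem of this file headed by the crux constant. -/

/-- **The glue, hypothesis form (real proof).** deep-range statement → Siegel–Walfisz-range statement →
the crux formula (verbatim the definiens of `TwinMinorArcs.TupleMinorArcUniformity`). Proof: take
`K, N_A` from the deep statement, `Q, N_B` from the shallow statement at that `K`, answer with this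
`Q` and `N₀ = max (max N_A N_B) 1`; for `N ≥ N₀` and `α` off the `Q`-major arcs put `L = (log N)^K`:
if `N < L`, the pair `(round α, 1)` is shallow (`1 < L`, `|α − round α| ≤ 1/2 ≤ L/N`); otherwise
Dirichlet (`Real.exists_rat_abs_sub_le_and_den_le`) at height `T = max 1 ⌊N/L⌋` gives a reduced
`r = a/q`, `q ≤ T`, `|α − r| ≤ 1/((T+1)q)`, which is shallow if `q < L` (`N/L < T + 1`) and deep
if `L ≤ q` (`q ≤ T` forces `qL ≤ N`; `q ≤ T + 1` gives `1/((T+1)q) ≤ 1/q²`). -/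
theorem TupleMinorArcUniformity_of_ranges
    (hA : ∀ (t : ℕ) (Φ : Fin t → Literature.NumberTheory.Sieve.AffLinForm 1), 1 ≤ t →
      Literature.NumberTheory.Sieve.IsNondegenerateSystem Φ → ∀ ε : ℝ, 0 < ε →
        ∃ K N₀ : ℕ, ∀ N : ℕ, N₀ ≤ N → ∀ (α : ℝ) (a : ℤ) (q : ℕ), 1 ≤ q → Int.gcd a q = 1 →
          Real.log N ^ K ≤ q → (q : ℝ) * Real.log N ^ K ≤ N → |α - a / q| ≤ 1 / (q : ℝ) ^ 2 →
            ‖∑ n ∈ Finset.Icc 1 N, ((∏ i, Literature.NumberTheory.Sieve.intVonMangoldt ((Φ i).eval ![(n : ℤ)]) : ℝ) : ℂ) * Complex.exp (2 * Real.pi * Complex.I * (α * n))‖ ≤ ε * N)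
    (hB : ∀ (t : ℕ) (Φ : Fin t → Literature.NumberTheory.Sieve.AffLinForm 1), 1 ≤ t →
      Literature.NumberTheory.Sieve.IsNondegenerateSystem Φ → ∀ (K : ℕ) (ε : ℝ), 0 < ε →
        ∃ Q : ℝ, 0 < Q ∧ ∃ N₀ : ℕ, ∀ N : ℕ, N₀ ≤ N → ∀ α : ℝ,
          (∀ q : ℕ, 1 ≤ q → (q : ℝ) ≤ Q → ∀ a : ℤ, Q / N < |α - a / q|) →
            ∀ (a : ℤ) (q : ℕ), 1 ≤ q → Int.gcd a q = 1 → (q : ℝ) < Real.log N ^ K →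
              |α - a / q| ≤ Real.log N ^ K / (q * N) →
                ‖∑ n ∈ Finset.Icc 1 N, ((∏ i, Literature.NumberTheory.Sieve.intVonMangoldt ((Φ i).eval ![(n : ℤ)]) : ℝ) : ℂ) * Complex.exp (2 * Real.pi * Complex.I * (α * n))‖ ≤ ε * N) :
    ∀ (t : ℕ) (Φ : Fin t → Literature.NumberTheory.Sieve.AffLinForm 1), 1 ≤ t →
      Literature.NumberTheory.Sieve.IsNondegenerateSystem Φ → ∀ ε : ℝ, 0 < ε → ∃ Q : ℝ, 0 < Q ∧
        ∃ N₀ : ℕ, ∀ N : ℕ, N₀ ≤ N → ∀ α : ℝ,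
          (∀ q : ℕ, 1 ≤ q → (q : ℝ) ≤ Q → ∀ a : ℤ, Q / N < |α - a / q|) →
            ‖∑ n ∈ Finset.Icc 1 N, ((∏ i, Literature.NumberTheory.Sieve.intVonMangoldt ((Φ i).eval ![(n : ℤ)]) : ℝ) : ℂ) * Complex.exp (2 * Real.pi * Complex.I * (α * n))‖ ≤ ε * N := by
  intro t Φ ht hΦ ε hε
  obtain ⟨K, NA, hKA⟩ := hA t Φ ht hΦ ε hε
  obtain ⟨Q, hQ, NB, hKB⟩ := hB t Φ ht hΦ K ε hε
  refine ⟨Q, hQ, max (max NA NB) 1, ?_⟩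
  intro N hN α hmin
  have hNA : NA ≤ N := le_trans (le_trans (le_max_left _ _) (le_max_left _ _)) hN
  have hNB : NB ≤ N := le_trans (le_trans (le_max_right _ _) (le_max_left _ _)) hN
  have hN1 : 1 ≤ N := le_trans (le_max_right _ _) hN
  have hN1r : (1 : ℝ) ≤ N := by exact_mod_cast hN1
  have hNpos : (0 : ℝ) < N := lt_of_lt_of_le one_pos hN1r
  -- the handover height `L = (log N)^K`
  set L : ℝ := Real.log N ^ K with hL
  have hL0 : 0 ≤ L := pow_nonneg (Real.log_nonneg hN1r) K
  rcases lt_or_ge (N : ℝ) L with hNL | hLN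
  · -- Case 1: `N < (log N)^K` (small `N`): the trivial approximation `a/q = round α / 1` is shallow.
    have h1L : (1 : ℝ) < L := lt_of_le_of_lt hN1r hNL
    have hgcd : Int.gcd (round α) (1 : ℕ) = 1 := by
      rw [Int.gcd_eq_natAbs]
      simp
    have hq : ((1 : ℕ) : ℝ) < Real.log N ^ K := by simpa using h1L
    have hβ : |α - (round α : ℤ) / ((1 : ℕ) : ℝ)| ≤ Real.log N ^ K / ((1 : ℕ) * N) := by
      have h1 : |α - round α| ≤ 1 / 2 := abs_sub_round α
      have h2 : (1 : ℝ) ≤ L / N := by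
        rw [le_div_iff₀ hNpos]
        linarith
      simp only [Nat.cast_one, div_one, one_mul]
      linarith
    exact hKB N hNB α hmin (round α) 1 le_rfl hgcd hq hβ
  · -- Case 2: `(log N)^K ≤ N`: Dirichlet at height `T = max 1 ⌊N / (log N)^K⌋₊`.
    set T : ℕ := max 1 ⌊(N : ℝ) / L⌋₊ with hT
    have hTpos : 0 < T := lt_of_lt_of_le one_pos (le_max_left _ _)
    obtain ⟨r, hr, hden⟩ := Real.exists_rat_abs_sub_le_and_den_le α hTpos
    have hden1 : 1 ≤ r.den := r.pos
    have hdenpos : (0 : ℝ) < r.den := by exact_mod_cast r.pos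
    have hgcd : Int.gcd r.num r.den = 1 := by
      rw [Int.gcd_eq_natAbs, Int.natAbs_natCast]
      exact r.reduced
    have habs : |α - (r.num : ℝ) / (r.den : ℝ)| = |α - r| := by
      rw [Rat.cast_def]
    have hTr : (0 : ℝ) < (T : ℝ) + 1 := by positivity
    rcases lt_or_ge (r.den : ℝ) L with hdL | hLd
    · -- Case 2a: shallow denominator `r.den < (log N)^K` → `stub_polylogConductors`.
      have hLpos : 0 < L := lt_trans hdenpos hdL
      have hT1 : (N : ℝ) / L < (T : ℝ) + 1 := by
        have h1 : (N : ℝ) / L < ⌊(N : ℝ) / L⌋₊ + 1 := Nat.lt_floor_add_one _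
        have h2 : (⌊(N : ℝ) / L⌋₊ : ℝ) ≤ T := by exact_mod_cast le_max_right _ _
        linarith
      have hNLT : (N : ℝ) < L * ((T : ℝ) + 1) := by
        rw [div_lt_iff₀ hLpos] at hT1
        linarith
      have hβ : |α - (r.num : ℝ) / (r.den : ℝ)| ≤ Real.log N ^ K / (r.den * N) := by
        rw [habs]
        refine hr.trans ?_
        rw [div_le_div_iff₀ (by positivity) (by positivity)]
        nlinarith [hNLT, hdenpos.le]
      exact hKB N hNB α hmin r.num r.den hden1 hgcd hdL hβ
    · -- Case 2b: deep denominator `(log N)^K ≤ r.den ≤ N / (log N)^K` → `stub_deepMinorArcs`.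
      have hqL : (r.den : ℝ) * Real.log N ^ K ≤ N := by
        rcases eq_or_lt_of_le hL0 with hL0' | hLpos
        · rw [← hL, ← hL0', mul_zero]
          exact hNpos.le
        · rcases Nat.eq_zero_or_pos ⌊(N : ℝ) / L⌋₊ with h0 | hpos
          · have hT1 : T = 1 := by rw [hT, h0]; rfl
            have hd1 : r.den = 1 := le_antisymm (hT1 ▸ hden) hden1
            rw [← hL, hd1, Nat.cast_one, one_mul]
            exact hLN
          · have hTeq : T = ⌊(N : ℝ) / L⌋₊ := max_eq_right hpos
            have h1 : (r.den : ℝ) ≤ ⌊(N : ℝ) / L⌋₊ := by exact_mod_cast hTeq ▸ hden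
            have h2 : (⌊(N : ℝ) / L⌋₊ : ℝ) ≤ (N : ℝ) / L := Nat.floor_le (by positivity)
            have h3 : (r.den : ℝ) ≤ N / L := h1.trans h2
            rw [le_div_iff₀ hLpos] at h3
            rw [← hL]
            exact h3
      have hβ : |α - (r.num : ℝ) / (r.den : ℝ)| ≤ 1 / (r.den : ℝ) ^ 2 := by
        rw [habs]
        refine hr.trans ?_
        have hdT : (r.den : ℝ) ≤ (T : ℝ) + 1 := by exact_mod_cast Nat.le_succ_of_le hden
        rw [div_le_div_iff₀ (by positivity) (by positivity), one_mul, one_mul, sq]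
        exact mul_le_mul_of_nonneg_right hdT hdenpos.le
      exact hKA N hNA α r.num r.den hden1 hgcd hLd hqL hβ

/-- **BC3 composition / A12 skeleton theorem.** The crux `TwinMinorArcs.TupleMinorArcUniformity`,
concluded BY NAME and with no hypotheses, from the two stubs through the proved glue
`TupleMinorArcUniformity_of_ranges` (the explicit formula is accepted at the route decl's type by
definitional unfolding alone). Its only non-whitelisted axiom is the `sorryAx` of the two stubs. -/
theorem TupleMinorArcUniformity_of :
    Summit.Parity.GeneralizedHardyLittlewood.Theses.TwinMinorArcs.TupleMinorArcUniformity :=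
  TupleMinorArcUniformity_of_ranges stub_deepMinorArcs stub_polylogConductors

end Summit.Parity.GeneralizedHardyLittlewood.Cruxes.TupleMinorArcUniformity.Birth
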